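/-
  Summits/AtomisticToContinuum/Crystallization/Theorems/OverbindingBudgetAffineFarSlotRecordV15.lean

  residual stmt-AtomisticToContinuum-31280 · slot Z `FarAggregatePricing 12 (1/25) (1/2000) (1/(2·10⁷))`: ★ RECORD v15′ — the leaf list after
  Zr‴b (`normalCorePricing_holds`, Z3 v2), Z3a (`tailDriftBound_holds`), LAB₁′ ⟸ `BallBarlowFact` (E4 part 5) and Zr‴a′ ⟸ `BallBarlowFact`
  (Zr‴a′ part 2): slot Z ⟸ R_aff′ ∧ Z2 ∧ BBI₀ ∧ Z4″.
  decomp-a2c lens-4, generation 59.  0 sorry · 0 axiom · no instance · no notation · no option.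
-/
import Summits.AtomisticToContinuum.Crystallization.Theorems.OverbindingBudgetAffineFarEngineGlue
import Summits.AtomisticToContinuum.Crystallization.Theorems.OverbindingBudgetAffineFarCharting
import Summits.AtomisticToContinuum.Crystallization.Theorems.OverbindingBudgetAffineFarCorePricing
import Summits.AtomisticToContinuum.Crystallization.Theorems.OverbindingBudgetAffineFarTailDrift

/-! # ★ Slot Z, record v15′: `FarAggregatePricing 12 (1/25) (1/2000) (1/(2·10⁷))` ⟸ R_aff′ ∧ Z2 ∧ BBI₀ ∧ Z4″

Record v14′ (`farAggregatePricing_record_of_leaves_v14'`, `…FarFirstShellLabelling`) with its three PROVED leaves discharged — Zr‴b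
`normalCorePricing_holds` (`…FarCorePricing`), Z3a `tailDriftBound_holds` (`…FarTailDrift`) — and its two Barlow-identification leaves LAB₁′,
Zr‴a′ replaced by their common antecedent, the port `BallBarlowFact` (`shelteredShellLabelling'_of_ballBarlowFact`, `…FarEngineGlue`;
`shelteredFarCharting'_of_ballBarlowFact`, `…FarCharting`).  Open after v15′: R_aff′ `AffineChartStraightening'` [M] · Z2 `FarCoreExcess` [CERT] ·
BBI₀ `BallBarlowFact` [port·S] · Z4″ `ScaleBadFloor` [M+CERT].
-/

namespace Summit.AtomisticToContinuum.Crystallization.Theorems.OverbindingBudgetAffineFarSmoothSplit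

open Summit.AtomisticToContinuum.Crystallization.Theorems.OverbindingBudgetAffineLocalisation

/-- ★ **SLOT Z, RECORD v15′**: `AffineChartStraightening' → FarCoreExcess → BallBarlowFact → ScaleBadFloor →
FarAggregatePricing 12 (1/25) (1/2000) (1/(2·10⁷))` — R_aff′ (M, shared) · Z2 (CERT) · BBI₀ (port·S) · Z4″ (M+CERT). [this file] -/
theorem farAggregatePricing_record_of_leaves_v15' (hR' : AffineChartStraightening')
    (h2 : FarCoreExcess (1 / 25) (1 / 2000) (1 / (2 * 10 ^ 7))) (hBB : BallBarlowFact)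
    (h4 : ScaleBadFloor (1 / 25) (1 / (2 * 10 ^ 7))) :
    FarAggregatePricing 12 (1 / 25) (1 / 2000) (1 / (2 * 10 ^ 7)) :=
  farAggregatePricing_record_of_leaves_v14' hR' h2 (shelteredFarCharting'_of_ballBarlowFact hBB) normalCorePricing_holds
    tailDriftBound_holds (shelteredShellLabelling'_of_ballBarlowFact hBB) h4

/-- v14′ factors through v15′'s inputs: with BBI♯ in hand instead of the port, the same closure (PROVED). [this file] -/
theorem farAggregatePricing_record_of_leaves_v15'_sharp (hR' : AffineChartStraightening')
    (h2 : FarCoreExcess (1 / 25) (1 / 2000) (1 / (2 * 10 ^ 7))) (hBBI : BarlowBallIdentificationSharp)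
    (h4 : ScaleBadFloor (1 / 25) (1 / (2 * 10 ^ 7))) :
    FarAggregatePricing 12 (1 / 25) (1 / 2000) (1 / (2 * 10 ^ 7)) :=
  farAggregatePricing_record_of_leaves_v14' hR' h2 (shelteredFarCharting'_of_engine hBBI) normalCorePricing_holds
    tailDriftBound_holds (shelteredShellLabelling'_of_engine hBBI coreRechartSharp_holds) h4

end Summit.AtomisticToContinuum.Crystallization.Theorems.OverbindingBudgetAffineFarSmoothSplit
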